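import Literature.NumberTheory.PAdicHodge.LubinTateWittTwistOrbit
import Literature.NumberTheory.PAdicHodge.LubinTateWittDivisionTowerCoeff
import Literature.NumberTheory.PAdicHodge.LubinTateCharacterConjugatesTotallyRamifiedAnyPrime
import Literature.NumberTheory.PAdicHodge.EisensteinCoeffWittLubinTate
import HarnessLib

/-!
# Eigenvectors for the Frobenius-twisted conjugates of the Lubin–Tate character (general residue degree)

Topic `Literature/NumberTheory/PAdicHodge`; THEOREMS only (solo-Langlands-informed Stage E2.9b part 2b: the
`W(k_F)`-coefficient version of the eigenvector construction of `LubinTateCharacterConjugatesTotallyRamifiedAnyPrime`).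
Let `F/ℚ_p` be finite with `#k_F = q = p^f`, `D` a `W(k_F)`-Eisenstein datum with `D.unif = π` a uniformizer
(tree `EisensteinRootW`), `x_t ∈ A_inf(𝒪_F)` Fontaine's element of the `π`-division tower (`AinfRamWTop.ltTorsionLift`),
and `ϑ = ϑ_{j,ρ} : A_inf(𝒪_F) → 𝒪_{ℂ_F}` the conjugate specialisation twisted by `φ^j` on `W(k_F)` with `ϑ(ϖ) = ρ`, a root
of the `φ^j`-conjugate Eisenstein polynomial with `‖ρ‖ = ‖π‖` (`AinfRamWTop.thetaTwist`, tree `LubinTateWittTwistOrbit`).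

* `norm_ltMap_eq_of_norm_sub_pow_le` — the **level-one estimate** (generic ultrametric lemma): if `ϖt₁ + t₁^q = 0`,
  `t₁ ≠ 0`, `‖y₁ − t₁ⁿ‖ ≤ ‖ϖ‖` with `1 < n < q − 1` and `y₀ = ρy₁ + y₁^q`, `‖ρ‖ = ‖ϖ‖ < 1`, then
  `‖y₀‖ = ‖ϖ‖·‖t₁‖ⁿ ≠ 0` and `‖y₀‖^{q−1} < ‖ρ‖` (used with `n = p^j`, `0 < j < f`);
* `AinfRamW.thetaTwist_zero_sub_theta_mem`, `AinfRamWTop.norm_thetaTwist_zero_sub_theta_le` — for `j = 0`,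
  `ϑ_{0,ρ}(x) − θ_𝒪(x) ∈ (ρ − π)`, so `‖ϑ_{0,ρ}(x) − θ_𝒪(x)‖ ≤ ‖ρ − π‖` (input of the level-two estimate
  `norm_ltMap_ltMap_eq_of_norm_sub_le`);
* ★★ `exists_eigenvector_of_thetaTwist` — for `j < f`, and `ρ ≠ π` if `j = 0`: there is `u ∈ ℂ_F`, `u ≠ 0`, with
  **`σ(u) = ϑ(a)·u`** for every `σ ∈ Γ_F` fixing `ρ` and every `a ∈ 𝒪_D = W(k_F)[ϖ]` with `a ↦ χ_π(σ)` in `𝒪_F`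
  (`u = λ_ρ(ϑ(x_t))`, Lang's limit; `ϑ(x_t) ≠ 0` by the level-two estimate for `j = 0` and by the level-one estimate
  `‖ϑ(x_{t⁺})‖ = ‖t₁‖^{p^j}` for `0 < j < f`). With the classification of the `ℚ_p`-embeddings of `F` restricted to
  `𝒪_D` (`e|_{W(k_F)} = φ^j`, `e(π) = ρ`) this is hypothesis (H) `LubinTateCharacterConjugateAdmissible` for general `F`
  — `lubinTateCharacterConjugateAdmissible_of_twistClassification` records exactly this reduction (classification,
  `‖e(π)‖ = ‖π‖`, `χ_π(Γ_F) ⊆ im 𝒪_D` as hypotheses; sequel).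

## References
* J.-P. Serre, *Abelian ℓ-adic representations and elliptic curves* (1968), Ch. III §A.4–A.5. [SerreAbelianLadic1968]
* P. Colmez, *Périodes des variétés abéliennes à multiplication complexe*, Ann. of Math. 138 (1993), §I.2. [Colmez1993]
* S. Lang, *Cyclotomic Fields I and II* (1990), Ch. 8 §6 Lemma 1. [LangCyclotomic1990]
* J.-M. Fontaine, *Le corps des périodes p-adiques*, Astérisque 223 (1994), Exp. II §1.2.2. [FontaineAsterisque223III]
* J. W. S. Cassels, A. Fröhlich (eds.), *Algebraic Number Theory* (1967), Ch. VI §3.4 Thm. 3. [CasselsFrohlichANT1967]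
-/

noncomputable section

open IsLocalRing WittVector

namespace Literature.NumberTheory.PAdicHodge

open Literature.NumberTheory.GaloisRepresentations
open Literature.NumberTheory.GaloisRepresentations.IsNonarchimedeanLocalField
open Literature.NumberTheory.GaloisRepresentations.LubinTate
open Field ValuativeRel

/-! ## §1 The level-one estimate `‖ρy₁ + y₁^q‖ = ‖ϖ‖·‖t₁‖ⁿ` when `‖y₁ − t₁ⁿ‖ ≤ ‖ϖ‖`, `1 < n < q − 1` -/

section LevelOne

variable {K : Type*} [NormedField K] [IsUltrametricDist K]

/-- **Level-one estimate.** In an ultrametric field let `ϖt₁ + t₁^q = 0`, `t₁ ≠ 0`, `‖ρ‖ = ‖ϖ‖ < 1`, `y₀ = ρy₁ + y₁^q`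
and `‖y₁ − t₁ⁿ‖ ≤ ‖ϖ‖` with `1 < n < q − 1`. Then `‖t₁‖^{q−1} = ‖ϖ‖ < ‖t₁‖ⁿ = ‖y₁‖ < 1`, the term `ρy₁` dominates,
**`‖y₀‖ = ‖ϖ‖·‖t₁‖ⁿ`** (so `y₀ ≠ 0`), and `y₀` lies in the convergence regime `‖y₀‖^{q−1} < ‖ρ‖` of Lang's limit.
[cite: SerreAbelianLadic1968, Ch. III §A.5] [cite: LangCyclotomic1990, Ch. 8 §6 Lemma 1] -/
theorem norm_ltMap_eq_of_norm_sub_pow_le {q n : ℕ} (hq : 2 ≤ q) (hn1 : 1 < n) (hnq : n < q - 1)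
    {ρ ϖ t₁ y₀ y₁ : K} (hρϖ : ‖ρ‖ = ‖ϖ‖) (hϖ1 : ‖ϖ‖ < 1) (ht₁ : ϖ * t₁ + t₁ ^ q = 0) (ht₁0 : t₁ ≠ 0)
    (hy₀ : y₀ = ρ * y₁ + y₁ ^ q) (hy₁ : ‖y₁ - t₁ ^ n‖ ≤ ‖ϖ‖) :
    ‖y₀‖ = ‖ϖ‖ * ‖t₁‖ ^ n ∧ 0 < ‖t₁‖ ^ n ∧ ‖y₀‖ ^ (q - 1) < ‖ρ‖ := by
  have ht₁pos : 0 < ‖t₁‖ := norm_pos_iff.2 ht₁0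
  -- `t₁^{q-1} = -ϖ`, so `‖t₁‖^{q-1} = ‖ϖ‖`
  have hpow : ‖t₁‖ ^ (q - 1) = ‖ϖ‖ := by
    have h1 : t₁ * (ϖ + t₁ ^ (q - 1)) = 0 := by
      rw [mul_add, mul_comm, ← pow_succ', Nat.sub_add_cancel (by omega : 1 ≤ q)]; exact ht₁
    have h2 : ϖ + t₁ ^ (q - 1) = 0 := (mul_eq_zero.1 h1).resolve_left ht₁0
    rw [← norm_pow, eq_neg_of_add_eq_zero_right h2, norm_neg]
  have hϖpos : 0 < ‖ϖ‖ := by rw [← hpow]; exact pow_pos ht₁pos _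
  have ht₁1 : ‖t₁‖ < 1 := by
    by_contra h
    have h1 : 1 ≤ ‖t₁‖ ^ (q - 1) := one_le_pow₀ (not_lt.1 h)
    rw [hpow] at h1
    exact absurd hϖ1 (not_lt.2 h1)
  -- `‖ϖ‖ < ‖t₁‖ⁿ = ‖y₁‖ < 1`
  have hn_gt : ‖ϖ‖ < ‖t₁‖ ^ n := by
    rw [← hpow]; exact pow_lt_pow_right_of_lt_one₀ ht₁pos ht₁1 hnq
  have hy₁n : ‖y₁‖ = ‖t₁‖ ^ n := by
    have hlt : ‖y₁ - t₁ ^ n‖ < ‖t₁ ^ n‖ := by rw [norm_pow]; exact hy₁.trans_lt hn_gt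
    have h := IsUltrametricDist.norm_add_eq_max_of_norm_ne_norm hlt.ne
    rwa [sub_add_cancel, max_eq_right hlt.le, norm_pow] at h
  have hrpos : 0 < ‖t₁‖ ^ n := pow_pos ht₁pos n
  have hr1 : ‖t₁‖ ^ n < 1 := pow_lt_one₀ ht₁pos.le ht₁1 (by omega)
  -- regime for `y₁`: `‖y₁‖^{q-1} = ‖t₁‖^{n(q-1)} < ‖t₁‖^{q-1} = ‖ρ‖`
  have hy₁reg : ‖y₁‖ ^ (q - 1) < ‖ρ‖ := by
    have h2 : 2 * (q - 1) ≤ n * (q - 1) := Nat.mul_le_mul_right _ hn1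
    rw [hy₁n, hρϖ, ← hpow, ← pow_mul]
    exact pow_lt_pow_right_of_lt_one₀ ht₁pos ht₁1 (by omega)
  -- `‖y₀‖ = ‖ρ‖·‖y₁‖`
  have hy₀n : ‖y₀‖ = ‖ρ‖ * ‖y₁‖ := by
    have h := LangLimit.norm_ltMap (ρ := ρ) hq hy₁reg
    rw [LangLimit.ltMap] at h
    rw [hy₀]; exact h
  refine ⟨by rw [hy₀n, hρϖ, hy₁n], hrpos, ?_⟩
  rw [hy₀n, hy₁n, hρϖ, mul_pow]
  calc ‖ϖ‖ ^ (q - 1) * (‖t₁‖ ^ n) ^ (q - 1) < ‖ϖ‖ ^ (q - 1) * 1 :=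
        mul_lt_mul_of_pos_left (pow_lt_one₀ hrpos.le hr1 (by omega)) (pow_pos hϖpos _)
    _ ≤ ‖ϖ‖ := by rw [mul_one]; exact pow_le_of_le_one hϖpos.le hϖ1.le (by omega)

end LevelOne

/-! ## §2 `j = 0`: `ϑ_{0,ρ}(x) − θ_𝒪(x) ∈ (ρ − π)` -/

variable {F : Type} [Field F] [ValuativeRel F] [TopologicalSpace F] [IsNonarchimedeanLocalField F] [CharZero F]
  {p : ℕ} [Fact p.Prime] {hp : valuation F p < 1}

section JZero

variable [Fact (¬ IsUnit (p : integerC F))] [IsAdicComplete (Ideal.span {(p : integerC F)}) (integerC F)]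
  (D : EisensteinRootW F p hp) {ρ : integerC F} (hρ : D.poly.eval₂ (twistCoeff hp 0) ρ = 0)

/-- **`ϑ_{0,ρ}(x) − θ_𝒪(x) ∈ (ρ − π)𝒪_{ℂ_F}`**: for `j = 0` the two specialisations agree on `W(k_F)` and send `ϖ` to
`ρ`, `π` respectively, and `ρ − π ∣ g(ρ) − g(π)`. [cite: SerreAbelianLadic1968, Ch. III §A.5] -/
theorem AinfRamW.thetaTwist_zero_sub_theta_mem (x : AinfRamW D) :
    AinfRamW.thetaTwist D 0 hρ x - AinfRamW.theta D x ∈ Ideal.span {ρ - D.unifC} := by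
  obtain ⟨g, rfl⟩ := AdjoinRoot.mk_surjective x
  rw [AinfRamW.thetaTwist_mk, AinfRamW.theta_mk, pow_zero, RingHom.one_def, RingHom.comp_id,
    Polynomial.eval₂_eq_eval_map, Polynomial.eval₂_eq_eval_map]
  exact Ideal.mem_span_singleton.2 (Polynomial.sub_dvd_eval_sub _ _ _)

/-- Norm form on `AinfRamWTop`: **`‖ϑ_{0,ρ}(x) − θ_𝒪(x)‖ ≤ ‖ρ − π‖`** (the input `hy₂` of the level-two estimate
`norm_ltMap_ltMap_eq_of_norm_sub_le`). [cite: SerreAbelianLadic1968, Ch. III §A.5] -/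
theorem AinfRamWTop.norm_thetaTwist_zero_sub_theta_le (x : AinfRamWTop D) :
    ‖((AinfRamWTop.thetaTwist D 0 hρ x : CBall F) : CompletedAlgClosure F) -
        ((AinfRamWTop.theta D x : CBall F) : CompletedAlgClosure F)‖ ≤
      ‖(ρ : CompletedAlgClosure F) - algebraMap F (CompletedAlgClosure F) D.unif‖ := by
  set a : AinfRamW D := (AinfRamWTop.of D).symm x with ha
  have hx : x = AinfRamWTop.of D a := ((AinfRamWTop.of D).apply_symm_apply x).symm
  rw [hx]
  obtain ⟨y, hy⟩ := Ideal.mem_span_singleton'.1 (AinfRamW.thetaTwist_zero_sub_theta_mem D hρ a)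
  have h : ((AinfRamWTop.thetaTwist D 0 hρ (AinfRamWTop.of D a) : CBall F) : CompletedAlgClosure F) -
      ((AinfRamWTop.theta D (AinfRamWTop.of D a) : CBall F) : CompletedAlgClosure F) =
      (y : CompletedAlgClosure F) * ((ρ : CompletedAlgClosure F) - algebraMap F (CompletedAlgClosure F) D.unif) := by
    rw [AinfRamWTop.coe_thetaTwist, AinfRamWTop.coe_theta, ← AddSubgroupClass.coe_sub, ← hy, MulMemClass.coe_mul,
      AddSubgroupClass.coe_sub, EisensteinRootW.coe_unifC]
  rw [h, norm_mul]
  exact mul_le_of_le_one_left (norm_nonneg _) (norm_coe_integerC_le y)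

end JZero

/-! ## §3 ★★ The eigenvector `u = λ_ρ(ϑ(x_t))` -/

set_option maxHeartbeats 1600000 in
/-- ★★ **Eigenvectors for the twisted conjugate characters.** Let `D` be a `W(k_F)`-Eisenstein datum of `F` with
`D.unif = π` a uniformizer, `#k_F = p^f`, `j < f`, and `ρ ∈ 𝒪_{ℂ_F}` a root of the `φ^j`-conjugate Eisenstein polynomial
with `‖ρ‖ = ‖π‖` (and `ρ ≠ π` if `j = 0`). Then there is `u ∈ ℂ_F`, `u ≠ 0`, such that for every `σ ∈ Γ_F` fixing `ρ`
and every `a ∈ 𝒪_D = W(k_F)[ϖ]` mapping to `χ_π(σ)` in `𝒪_F`, **`σ(u) = ϑ_{j,ρ}(a)·u`** — `u = λ_ρ(ϑ(x_t))` is Lang's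
limit of the twisted specialisation of Fontaine's element of the `π`-division tower, non-zero by the level-two estimate
(`j = 0`) or the level-one estimate (`0 < j < f`), and `σ x_t = [a]_P x_t` linearises under `λ_ρ ∘ ϑ`.
[cite: SerreAbelianLadic1968, Ch. III §A.5] [cite: Colmez1993, §I.2] [cite: LangCyclotomic1990, Ch. 8 §6]
[cite: FontaineAsterisque223III, Exp. II §1.2.2] -/
theorem exists_eigenvector_of_thetaTwist [Fact (¬ IsUnit (p : integerC F))]
    [IsAdicComplete (Ideal.span {(p : integerC F)}) (integerC F)] (D : EisensteinRootW F p hp) {π : 𝒪[F]}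
    (hπ : (valuation F).IsUniformizer (π : F)) (hπD : (π : F) = D.unif) {f : ℕ} (hq : residueFieldCard F = p ^ f)
    {j : ℕ} (hjf : j < f) {ρ : integerC F} (hρ : D.poly.eval₂ (twistCoeff hp j) ρ = 0)
    (hρπ : ‖(ρ : CompletedAlgClosure F)‖ = ‖algebraMap F (CompletedAlgClosure F) D.unif‖)
    (hne : j = 0 → (ρ : CompletedAlgClosure F) ≠ algebraMap F (CompletedAlgClosure F) D.unif) :
    ∃ u : CompletedAlgClosure F, u ≠ 0 ∧ ∀ σ : absoluteGaloisGroup F, σ • (ρ : CompletedAlgClosure F) = ρ →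
      ∀ a : D.Coeff, EisensteinRootW.Coeff.toInt D a = (lubinTateChar hπ σ : 𝒪[F]) →
        σ • u = ((AdjoinRoot.lift (twistCoeff hp j) ρ hρ a : integerC F) : CompletedAlgClosure F) * u := by
  have hθ : Function.Surjective (fontaineTheta (integerC F) p) := surjective_fontaineTheta_integerC hp
  have hp2 : 2 ≤ p := (Fact.out : p.Prime).two_le
  have hq2 : 2 ≤ residueFieldCard F := one_lt_residueFieldCard F
  have hf0 : f ≠ 0 := by
    rintro rfl
    rw [pow_zero] at hq
    omega
  have hpq : p ∣ residueFieldCard F := hq ▸ dvd_pow_self p hf0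
  have hA : IsLTRing (EisensteinRootW.CoeffDisc.of D (AdjoinRoot.root D.poly)) (residueFieldCard F) :=
    D.isLTRing_coeffDisc hq
  have hf : IsLTSeries (EisensteinRootW.CoeffDisc.of D (AdjoinRoot.root D.poly)) (residueFieldCard F)
      (ltSeries (EisensteinRootW.CoeffDisc.of D (AdjoinRoot.root D.poly)) (residueFieldCard F)) :=
    isLTSeries_ltSeries _ hq2
  have htp := EisensteinRootW.ltStepC_ltDivTower_succ D hπ hπD
  have htp' := AinfRamWTop.ltStepC_shift htp 1
  -- `π` and `ρ` in `ℂ_F`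
  have hϖ1 : ‖algebraMap F (CompletedAlgClosure F) D.unif‖ < 1 := D.norm_algebraMap_unif_lt_one
  have hϖ0 : algebraMap F (CompletedAlgClosure F) D.unif ≠ 0 := by
    intro h
    have h1 := D.norm_algebraMap_unif_pow
    rw [h, norm_zero, zero_pow D.deg_pos.ne'] at h1
    exact natCast_C_ne_zero (Fact.out : p.Prime).ne_zero (norm_eq_zero.1 h1.symm)
  have hρ0 : (ρ : CompletedAlgClosure F) ≠ 0 := by
    rw [← norm_pos_iff, hρπ, norm_pos_iff]; exact hϖ0
  have hρ1 : ‖(ρ : CompletedAlgClosure F)‖ < 1 := hρπ ▸ hϖ1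
  have hρπ' : ‖(ρ : CompletedAlgClosure F)‖ ≤ ‖((D.unifC : integerC F) : CompletedAlgClosure F)‖ := by
    rw [EisensteinRootW.coe_unifC]; exact hρπ.le
  -- `ϑ(c) = ρ` for the coefficient `c = ϖ_D`
  have hκc : ((AinfRamWTop.thetaTwist D j hρ (algebraMap (EisensteinRootW.CoeffDisc D) (AinfRamWTop D)
      (EisensteinRootW.CoeffDisc.of D (AdjoinRoot.root D.poly))) : CBall F) : CompletedAlgClosure F) = ρ :=
    AinfRamWTop.coe_thetaTwist_algebraMap_varpiDisc D j hρ
  -- Fontaine's elements `x_t`, `x_{t⁺}`, `x_{t⁺⁺}`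
  set x₀ : AinfRamWTop D := AinfRamWTop.ltTorsionLift (EisensteinRootW.CoeffDisc.of D (AdjoinRoot.root D.poly))
      (residueFieldCard_ne_zero F) hpq (k := D.deg) AinfRamWTop.algebraMap_varpiDisc_pow_mem_ideal hθ (ltDivTower hπ) htp
    with hx₀def
  set x₁ : AinfRamWTop D := AinfRamWTop.ltTorsionLift (EisensteinRootW.CoeffDisc.of D (AdjoinRoot.root D.poly))
      (residueFieldCard_ne_zero F) hpq (k := D.deg) AinfRamWTop.algebraMap_varpiDisc_pow_mem_ideal hθ
      (fun m => ltDivTower hπ (m + 1)) htp' with hx₁def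
  set x₂ : AinfRamWTop D := AinfRamWTop.ltTorsionLift (EisensteinRootW.CoeffDisc.of D (AdjoinRoot.root D.poly))
      (residueFieldCard_ne_zero F) hpq (k := D.deg) AinfRamWTop.algebraMap_varpiDisc_pow_mem_ideal hθ
      (fun m => ltDivTower hπ (m + 1 + 1))
      (AinfRamWTop.ltStepC_shift (t := fun m => ltDivTower hπ (m + 1)) htp' 1) with hx₂def
  have hx₀mem : x₀ ∈ (AinfRamWTop.nilTheta D hθ).toIdeal := by
    rw [hx₀def]; exact AinfRamWTop.ltTorsionLift_mem_nilTheta hpq _ htp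
  -- `θ_𝒪(x_{t⁺}) = t₁`, `θ_𝒪(x_{t⁺⁺}) = t₂`, `x_t = c·x_{t⁺} + x_{t⁺}^q`, `x_{t⁺} = c·x_{t⁺⁺} + x_{t⁺⁺}^q`
  have hθx₁ : AinfRamWTop.theta D x₁ = ((ltDivTower hπ 1 : (maxNilIdealC F).toIdeal) : CBall F) := by
    rw [hx₁def, AinfRamWTop.theta_ltTorsionLift_shift hpq _ htp]
  have hθx₂ : AinfRamWTop.theta D x₂ = ((ltDivTower hπ (1 + 1) : (maxNilIdealC F).toIdeal) : CBall F) := by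
    rw [hx₂def, AinfRamWTop.theta_ltTorsionLift_shift (t := fun m => ltDivTower hπ (m + 1)) hpq _ htp']
  have hx₀₁ : x₀ = algebraMap (EisensteinRootW.CoeffDisc D) (AinfRamWTop D)
      (EisensteinRootW.CoeffDisc.of D (AdjoinRoot.root D.poly)) * x₁ + x₁ ^ residueFieldCard F := by
    rw [hx₀def, hx₁def]; exact AinfRamWTop.coe_ltTorsionLift_eq_shift hpq _ htp
  have hx₁₂ : x₁ = algebraMap (EisensteinRootW.CoeffDisc D) (AinfRamWTop D)
      (EisensteinRootW.CoeffDisc.of D (AdjoinRoot.root D.poly)) * x₂ + x₂ ^ residueFieldCard F := by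
    rw [hx₁def, hx₂def]
    exact AinfRamWTop.coe_ltTorsionLift_eq_shift (t := fun m => ltDivTower hπ (m + 1)) hpq _ htp'
  -- `y_i = ϑ(x_i)`: `y₀ = ρ y₁ + y₁^q`, `y₁ = ρ y₂ + y₂^q`
  have hy₀₁ : ((AinfRamWTop.thetaTwist D j hρ x₀ : CBall F) : CompletedAlgClosure F) =
      (ρ : CompletedAlgClosure F) * ((AinfRamWTop.thetaTwist D j hρ x₁ : CBall F) : CompletedAlgClosure F) +
        ((AinfRamWTop.thetaTwist D j hρ x₁ : CBall F) : CompletedAlgClosure F) ^ residueFieldCard F := by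
    rw [hx₀₁, map_add, map_mul, map_pow, Subring.coe_add, Subring.coe_mul, SubmonoidClass.coe_pow, hκc]
  have hy₁₂ : ((AinfRamWTop.thetaTwist D j hρ x₁ : CBall F) : CompletedAlgClosure F) =
      (ρ : CompletedAlgClosure F) * ((AinfRamWTop.thetaTwist D j hρ x₂ : CBall F) : CompletedAlgClosure F) +
        ((AinfRamWTop.thetaTwist D j hρ x₂ : CBall F) : CompletedAlgClosure F) ^ residueFieldCard F := by
    rw [hx₁₂, map_add, map_mul, map_pow, Subring.coe_add, Subring.coe_mul, SubmonoidClass.coe_pow, hκc]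
  -- the tower relations `π t₁ + t₁^q = 0`, `t₁ ≠ 0`, `‖t₁‖ < 1`, `π t₂ + t₂^q = t₁`
  have ht₁ : algebraMap F (CompletedAlgClosure F) D.unif *
        (((ltDivTower hπ 1 : (maxNilIdealC F).toIdeal) : CBall F) : CompletedAlgClosure F) +
      (((ltDivTower hπ 1 : (maxNilIdealC F).toIdeal) : CBall F) : CompletedAlgClosure F) ^ residueFieldCard F = 0 := by
    have h := ltPoly_ltDivTower_succ hπ 0
    rwa [zero_add, hπD, coe_ltDivTower_zero, Subring.coe_zero] at h
  have ht₁0 : (((ltDivTower hπ 1 : (maxNilIdealC F).toIdeal) : CBall F) : CompletedAlgClosure F) ≠ 0 :=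
    fun h => ltDivTower_one_ne_zero hπ (ZeroMemClass.coe_eq_zero.1 h)
  have ht₁1 : ‖(((ltDivTower hπ 1 : (maxNilIdealC F).toIdeal) : CBall F) : CompletedAlgClosure F)‖ < 1 :=
    (ltDivTower hπ 1).2
  have ht₂ : algebraMap F (CompletedAlgClosure F) D.unif *
        (((ltDivTower hπ (1 + 1) : (maxNilIdealC F).toIdeal) : CBall F) : CompletedAlgClosure F) +
      (((ltDivTower hπ (1 + 1) : (maxNilIdealC F).toIdeal) : CBall F) : CompletedAlgClosure F) ^ residueFieldCard F =
      (((ltDivTower hπ 1 : (maxNilIdealC F).toIdeal) : CBall F) : CompletedAlgClosure F) := by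
    have h := ltPoly_ltDivTower_succ hπ 1
    rwa [hπD] at h
  -- KEY: `y₀ ≠ 0` and the convergence regime `‖y₀‖^{q-1} < ‖ρ‖`, by the level-two (`j = 0`) or level-one (`j > 0`) estimate
  have hkey : ((AinfRamWTop.thetaTwist D j hρ x₀ : CBall F) : CompletedAlgClosure F) ≠ 0 ∧
      ‖((AinfRamWTop.thetaTwist D j hρ x₀ : CBall F) : CompletedAlgClosure F)‖ ^ (residueFieldCard F - 1) <
        ‖(ρ : CompletedAlgClosure F)‖ := by
    rcases Nat.eq_zero_or_pos j with hj0 | hjpos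
    · subst hj0
      have hneρ := hne rfl
      have hy₂le : ‖((AinfRamWTop.thetaTwist D 0 hρ x₂ : CBall F) : CompletedAlgClosure F) -
          (((ltDivTower hπ (1 + 1) : (maxNilIdealC F).toIdeal) : CBall F) : CompletedAlgClosure F)‖ ≤
          ‖(ρ : CompletedAlgClosure F) - algebraMap F (CompletedAlgClosure F) D.unif‖ := by
        have h := AinfRamWTop.norm_thetaTwist_zero_sub_theta_le D hρ x₂
        rwa [hθx₂] at h
      have hy₀norm := norm_ltMap_ltMap_eq_of_norm_sub_le hq2 hρπ hϖ1 ht₁ ht₁0 ht₂ hy₁₂ hy₀₁ hy₂le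
      have hy₀0 : ((AinfRamWTop.thetaTwist D 0 hρ x₀ : CBall F) : CompletedAlgClosure F) ≠ 0 := by
        rw [← norm_pos_iff, hy₀norm]
        exact mul_pos (norm_pos_iff.2 (sub_ne_zero.2 hneρ)) (norm_pos_iff.2 ht₁0)
      refine ⟨hy₀0, ?_⟩
      have hδρ : ‖(ρ : CompletedAlgClosure F) - algebraMap F (CompletedAlgClosure F) D.unif‖ ≤
          ‖(ρ : CompletedAlgClosure F)‖ := by
        have h := IsUltrametricDist.norm_add_le_max (ρ : CompletedAlgClosure F)
          (-algebraMap F (CompletedAlgClosure F) D.unif)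
        rwa [← sub_eq_add_neg, norm_neg, ← hρπ, max_self] at h
      have h1 : ‖((AinfRamWTop.thetaTwist D 0 hρ x₀ : CBall F) : CompletedAlgClosure F)‖ <
          ‖(ρ : CompletedAlgClosure F)‖ := by
        rw [hy₀norm]
        calc _ ≤ ‖(ρ : CompletedAlgClosure F)‖ *
                ‖(((ltDivTower hπ 1 : (maxNilIdealC F).toIdeal) : CBall F) : CompletedAlgClosure F)‖ :=
              mul_le_mul_of_nonneg_right hδρ (norm_nonneg _)
          _ < ‖(ρ : CompletedAlgClosure F)‖ * 1 := mul_lt_mul_of_pos_left ht₁1 (norm_pos_iff.2 hρ0)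
          _ = _ := mul_one _
      calc _ ≤ ‖((AinfRamWTop.thetaTwist D 0 hρ x₀ : CBall F) : CompletedAlgClosure F)‖ :=
            pow_le_of_le_one (norm_nonneg _) (h1.le.trans hρ1.le) (by omega)
        _ < _ := h1
    · -- level one: `‖y₁ − t₁^{p^j}‖ ≤ ‖π‖ < ‖t₁‖^{p^j}` since `1 < p^j < q − 1`
      have hy₁le : ‖((AinfRamWTop.thetaTwist D j hρ x₁ : CBall F) : CompletedAlgClosure F) -
          (((ltDivTower hπ 1 : (maxNilIdealC F).toIdeal) : CBall F) : CompletedAlgClosure F) ^ p ^ j‖ ≤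
          ‖algebraMap F (CompletedAlgClosure F) D.unif‖ := by
        have h := AinfRamWTop.norm_thetaTwist_sub_theta_pow_le D j hρ hρπ' x₁
        rwa [hθx₁, EisensteinRootW.coe_unifC] at h
      have h1n : 1 < p ^ j := Nat.one_lt_pow hjpos.ne' (by omega)
      have hnq : p ^ j < residueFieldCard F - 1 := by
        have h2 : 2 ≤ p ^ j := h1n
        have h3 : p ^ j * p ≤ p ^ f := by
          rw [← pow_succ]; exact Nat.pow_le_pow_right (by omega) (by omega)
        have h4 : p ^ j * 2 ≤ p ^ j * p := Nat.mul_le_mul_left _ hp2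
        rw [hq]; omega
      obtain ⟨hnorm, hrpos, hreg⟩ :=
        norm_ltMap_eq_of_norm_sub_pow_le hq2 h1n hnq hρπ hϖ1 ht₁ ht₁0 hy₀₁ hy₁le
      exact ⟨by rw [← norm_pos_iff, hnorm]; exact mul_pos (norm_pos_iff.2 hϖ0) hrpos, hreg⟩
  obtain ⟨hy₀0, hy₀reg⟩ := hkey
  -- the eigenvector `u = λ_ρ(y₀)`
  refine ⟨LangLimit.langLog (ρ : CompletedAlgClosure F) (residueFieldCard F)
      ((AinfRamWTop.thetaTwist D j hρ x₀ : CBall F) : CompletedAlgClosure F),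
    LangLimit.langLog_ne_zero hq2 hρ0 hρ1 hy₀reg hy₀0, fun σ hσρ a ha => ?_⟩
  -- `σ x_t = [a]_P x_t` since `a ↦ χ_π(σ)` under `𝒪_D → 𝒪_F`
  have ha' : EisensteinRootW.CoeffDisc.toInt D (EisensteinRootW.CoeffDisc.of D a) = (lubinTateChar hπ σ : 𝒪[F]) := ha
  have hX : AinfRamWTop.gal D σ ((⟨x₀, hx₀mem⟩ : (AinfRamWTop.nilTheta D hθ).toIdeal) : AinfRamWTop D) =
      (ltSMul (AinfRamWTop.nilTheta D hθ) hA hf (EisensteinRootW.CoeffDisc.of D a) ⟨x₀, hx₀mem⟩ : AinfRamWTop D) :=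
    AinfRamWTop.gal_ltTorsionLift_of_galSeq_eq (hθ := hθ) hA hf hpq AinfRamWTop.algebraMap_varpiDisc_pow_mem_ideal σ
      (EisensteinRootW.CoeffDisc.of D a) htp (EisensteinRootW.galSeq_ltDivTower D hπ hπD hA hf σ ha')
  have hκ : ((AinfRamWTop.thetaTwist D j hρ (algebraMap (EisensteinRootW.CoeffDisc D) (AinfRamWTop D)
        (EisensteinRootW.CoeffDisc.of D a)) : CBall F) : CompletedAlgClosure F) =
      ((AdjoinRoot.lift (twistCoeff hp j) ρ hρ a : integerC F) : CompletedAlgClosure F) :=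
    AinfRamWTop.coe_thetaTwist_algebraMap_coeffDisc D j hρ a
  -- the quadratic bound along the orbit, linearised by Lang's limit
  have hbound := AinfRamWTop.norm_ltMap_iterate_smul_thetaTwist_sub_le D j hρ hA hf σ hσρ
    (EisensteinRootW.CoeffDisc.of D a) hX
  simp only [hκc] at hbound
  rw [CompletedAlgClosure.smul_def, LangLimit.map_langLog hq2 hρ0 hρ1 hy₀reg (CompletedAlgClosure.galRingHom σ)
      (CompletedAlgClosure.continuous_galRingHom σ) (by rw [← CompletedAlgClosure.smul_def, hσρ])
      (by rw [← CompletedAlgClosure.smul_def, CompletedAlgClosure.norm_smul]),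
    ← CompletedAlgClosure.smul_def, ← hκ]
  exact LangLimit.langLog_eq_mul hq2 hρ0 hρ1 hy₀reg (AinfRamWTop.norm_thetaTwist_le_one D j hρ _) hbound

/-! ## §4 Hypothesis (H) from the classification of the embeddings on `𝒪_D` -/

/-- **Hypothesis (H) `LubinTateCharacterConjugateAdmissible` for a general finite `F/ℚ_p`, reduced to three explicit
inputs about the `W(k_F)`-Eisenstein datum `D` (`D.unif = π`, `#k_F = p^f`)**: (1) the classification of the
`ℚ_p`-embeddings `e ≠ id` of `F` on `𝒪_D = W(k_F)[π]` — `e|_{W(k_F)} = φ^j` for some `j < f` and `e(π) = ρ` a root of the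
`φ^j`-conjugate Eisenstein polynomial, `ρ ≠ π` when `j = 0`, i.e. `e(a) = ϑ_{j,ρ}(a)` on `𝒪_D`; (2) `‖e(π)‖ = ‖π‖`;
(3) `χ_π(Γ_F) ⊆ im(𝒪_D → 𝒪_F)`. Then every `e ∘ χ_π`, `e ≠ id`, has a non-zero eigenvector in `ℂ_F`
(`exists_eigenvector_of_thetaTwist`). [cite: SerreAbelianLadic1968, Ch. III §A.4–A.5] [cite: Colmez1993, §I.2] -/
theorem lubinTateCharacterConjugateAdmissible_of_twistClassification [Fact (¬ IsUnit (p : integerC F))]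
    [IsAdicComplete (Ideal.span {(p : integerC F)}) (integerC F)] (D : EisensteinRootW F p hp) {π : 𝒪[F]}
    (hπ : (valuation F).IsUniformizer (π : F)) (hπD : (π : F) = D.unif) {f : ℕ} (hq : residueFieldCard F = p ^ f)
    (hcl : ∀ e : F →ₐ[PadicBase F p hp] NormedAlgClosure F,
      e ≠ IsScalarTower.toAlgHom (PadicBase F p hp) F (NormedAlgClosure F) →
        ∃ j < f, ∃ ρ : integerC F, ∃ hρ : D.poly.eval₂ (twistCoeff hp j) ρ = 0,
          (ρ : CompletedAlgClosure F) = ((e D.unif : NormedAlgClosure F) : CompletedAlgClosure F) ∧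
          (j = 0 → (ρ : CompletedAlgClosure F) ≠ algebraMap F (CompletedAlgClosure F) D.unif) ∧
          ∀ a : D.Coeff, ((e (EisensteinRootW.Coeff.toF D a) : NormedAlgClosure F) : CompletedAlgClosure F) =
            ((AdjoinRoot.lift (twistCoeff hp j) ρ hρ a : integerC F) : CompletedAlgClosure F))
    (hnorm : ∀ e : F →ₐ[PadicBase F p hp] NormedAlgClosure F,
      ‖((e D.unif : NormedAlgClosure F) : CompletedAlgClosure F)‖ = ‖algebraMap F (CompletedAlgClosure F) D.unif‖)
    (hχ : ∀ σ : absoluteGaloisGroup F, ∃ a : D.Coeff, EisensteinRootW.Coeff.toInt D a = (lubinTateChar hπ σ : 𝒪[F])) :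
    LubinTateCharacterConjugateAdmissible F p hp hπ := by
  intro M _ hM e he
  obtain ⟨j, hjf, ρ, hρ, hρe, hne, hcoef⟩ := hcl e he
  have hρπ : ‖(ρ : CompletedAlgClosure F)‖ = ‖algebraMap F (CompletedAlgClosure F) D.unif‖ := by
    rw [hρe]; exact hnorm e
  obtain ⟨u, hu0, hu⟩ := exists_eigenvector_of_thetaTwist D hπ hπD hq hjf hρ hρπ hne
  refine ⟨u, hu0, fun σ hσM => ?_⟩
  have hσρ : σ • (ρ : CompletedAlgClosure F) = ρ := by
    rw [hρe, CompletedAlgClosure.smul_coe, hσM _ (hM e D.unif)]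
  obtain ⟨a, ha⟩ := hχ σ
  rw [hu σ hσρ a ha, ← hcoef a, ← EisensteinRootW.Coeff.coe_toInt, ha]

end Literature.NumberTheory.PAdicHodge

end
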